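/-
Copyright: the b2b-balaban cell (near-miss cell 7), T⁴-continuum fan-out, lineage t4-ne7b-p3 (node U5c LARGE-DEVIATION
member P3).  Released under the licence of the surrounding project.
-/
import Summits.QuantumFields.BalabanUV.T4Continuum.Support.SpaceTimeAssemblyT

/-!
# Space-time Peierls ∕ Cramér route for NE7b — THE ASSEMBLY WITHOUT SEPARATION: a pinned contour may meet SEVERAL live
# components of a term; their tagged genealogies all pay, the per-cell rate adds up over the members

Summits-side support leaf of the T⁴-continuum cell (rung (B)+1 on a FINITE torus only; NOT infinite volume, NOT the
mass gap, NOT the Clay statement; NOT a proof of the spine estimate NE7b).  Lineage `t4-ne7b-p3` (generation 3), node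
U5c, skeleton `t4/skeletons/NE7b-t4-ne7b-p3.md` §15 (the separation-free road).  [folklore] assembly: `SpaceTimeAssemblyT`
(this lineage: `surplus_ge_rateB_T`, `volumeAccounting_of_consistentTLE_T`, `PayIneqs`) re-typed with a FINITE FAMILY of
member genealogies per pinned contour; `SpaceTimePinningK.factor_of_surplusK` (any surplus functional), `SpaceTimeOccBridge`,
`SpaceTimeThreshold`, `Lit.T4TaggedShapeBanking.exists_payThreshold`, `Lit.T4PrintedShapeBanking.one_le_R` — all BY NAME;
nothing printed is asserted; no `[cite:]` tag.

WHY.  §§12–14 put every contour inside ONE lineage by the reading `LatSep(T)` (distinct live components of a term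
neither intersect nor touch — print's merger criterion read contrapositively).  The route does not need it: if a
contour meets several members, EACH member's banked surplus pays for the cells it occupies, and the surpluses ADD
(`factor_of_surplusK` is linear in the surplus functional).  The factorisation reading is then stated with the product
of the members' banked factors — the same kind of reading as before (the (B)-upper machinery re-run with the pinned
components' factors stripped).

WHAT.
* §1 **`LineageReadingsM M Λ G …`**: the readings with, for every pinned contour, a finite family `mem τ 𝒦 : Finset Λ` of
  member lineages (tagged genealogies `G λ`, each `ConsistentTLE Prod.snd ∧ WF ∧ tcut ≤ reach`), a volume split
  `vol τ 𝒦 λ` with `#𝒦 ≤ Σ_λ vol` and `vol λ ≤ cA·treeD (G λ) + cB·treeSteps (G λ)`, the factorisation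
  `A τ ≤ e^{−Σ_λ (credits − lifeCost)(G λ)}·rest 𝒦 τ`, and the remainder; **`pinnedContourBound_of_readingsM`**.
* §2 **`RunReadingsFlowM`** (`∃ Cell … Λ G …`; the lineage type `Λ : Type`), `occLeaves_of_readingsM`, THE END **`exists_irThresholdM_relWeightBound`**
  (statement shape = the tagged END's with `RunReadingsFlowM`).

HONEST DEPENDENCY (cell, verbatim): continuum YM on T⁴ ⇐ BetaPertH ∧ nine spine estimates (0/9 proved); BetaPertH ⇐
(D1) ∧ (D4) ∧ CAP+tail; G-an2-4 gates asym, D1 and NE2/3/4.  This file changes none of it.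
-/

open Finset

namespace Summit.QuantumFields.BalabanUV.T4Continuum.SpaceTimePeierls

open Literature.MathematicalPhysics.QuantumFieldTheory.Balaban1983to89
open T4WeightBudget T4StabilitySocket T4PersistenceDictionary T4BankedInduction T4PrintedShapeBanking
open T4TaggedShapeBanking (dictWT costT exists_payThreshold)
open Summit.QuantumFields.BalabanUV.T4Continuum.HistoryBankingLE (ConsistentTLE)
open SpaceTimePeierlsLeaves

noncomputable section

/-! ## §1 The readings with member families and the pinned-contour bound -/

section OneRun

variable {ι : Type*} {Cell : Type} [Fintype Cell] {Λ : Type}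

open Classical in
/-- **THE LINEAGE READINGS WITH MEMBER FAMILIES** (no separation) of ONE run at one `(K, t)` over an occupancy model
`M`, with lineages `Λ` and their tagged genealogies `G`: entropy fields, nonnegativity, cover, and for every pinned
contour a finite family of MEMBER lineages — each LE-consistent, well formed and pending at the cut — with a volume
split of the contour over the members bounded by the members' tree data, the factorisation of the weight by the
PRODUCT of the members' banked factors, and the remainder bound.  A hypothesis shape; nothing asserted. [folklore] -/
structure LineageReadingsM (M : OccModel ι Cell) [DecidableRel M.Adj.Adj] (G : Λ → Gen (ℕ × PEv))
    (C : T4PrintedShapeBanking.Consts) (K Kc : ℕ) (R : ℕ → ℕ) (g : ℕ → ℝ) (A : ι → ℝ) (Bad : Finset ι) (jlo : ℕ)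
    (nup : ℝ) (Δ : ℕ) (Δ₁ Nanc cA cB dC c₃ : ℝ) : Prop where
  /-- entropy: degree bound of the space-time adjacency -/
  deg : ∀ c, M.Adj.degree c ≤ Δ
  /-- entropy: site animals (leaf A1) -/
  animal : SiteAnimalBound Δ Δ₁
  /-- entropy: the anchors (cells of the final scale `K`) -/
  anchors : (((univ : Finset Cell).filter fun c => M.scale c = K).card : ℝ) ≤ Nanc
  /-- I-2: nonnegative weights -/
  nonneg : ∀ τ ∈ M.T, 0 ≤ A τ
  /-- A2c: every bad term has a contour meeting every scale of `[jlo, K]` -/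
  cover : M.ContourCover Bad jlo K
  /-- A2b ∕ (ID) ∕ A3a ∕ A3e ∕ A3f: the member families of the pinned contours -/
  lineage : ∃ (mem : ι → Finset Cell → Finset Λ) (vol : ι → Finset Cell → Λ → ℕ) (rest : Finset Cell → ι → ℝ)
      (tcut : ι → Finset Cell → ℕ),
    (∀ (𝒦 : Finset Cell), ∀ τ ∈ M.T, M.IsContour τ 𝒦 →
        (∀ lam ∈ mem τ 𝒦, ConsistentTLE Prod.snd C Kc R (G lam) ∧ (G lam).WF (dictWT Prod.snd R C.n₁) ∧
          tcut τ 𝒦 ≤ (G lam).reach (dictWT Prod.snd R C.n₁) ∧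
          (vol τ 𝒦 lam : ℝ) ≤ cA * treeD tfat tstep dC (G lam) (tcut τ 𝒦) + cB * treeSteps tstep (G lam) (tcut τ 𝒦)) ∧
        (𝒦.card : ℝ) ≤ ∑ lam ∈ mem τ 𝒦, (vol τ 𝒦 lam : ℝ) ∧
        A τ ≤ Real.exp (-(∑ lam ∈ mem τ 𝒦, (credits (credit C g ∘ Prod.snd) (G lam) -
          lifeCost (dictWT Prod.snd R C.n₁) (costT Prod.snd C Kc R) (G lam)))) * rest 𝒦 τ) ∧
    (∀ (𝒦 : Finset Cell), ∀ τ ∈ M.T, 0 ≤ rest 𝒦 τ) ∧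
    (∀ (𝒦 : Finset Cell), ∑ τ ∈ M.T.filter (fun τ => M.IsContour τ 𝒦), rest 𝒦 τ ≤ Real.exp c₃ ^ 𝒦.card * nup)

variable {M : OccModel ι Cell} [DecidableRel M.Adj.Adj] {G : Λ → Gen (ℕ × PEv)} {C : T4PrintedShapeBanking.Consts}
  {K Kc : ℕ} {R : ℕ → ℕ} {g : ℕ → ℝ} {A : ι → ℝ} {Bad : Finset ι} {jlo : ℕ} {nup : ℝ} {Δ : ℕ}
  {Δ₁ Nanc cA cB dC c₃ : ℝ}

/-- **LEAF A3 WITHOUT SEPARATION.**  The member-family readings, valid constants with `0 ≤ A₀`, a nonnegative profile,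
(2.9), `L ≥ 1`, sizes `R ≥ 1`, the pay inequalities and positive cell constants give the PINNED-CONTOUR BOUND with
price `e^{−(rateB − c₃)}`: every member pays `rateB` per cell it covers (`surplus_ge_rateB_T`), the members cover the
contour, and the surpluses add. [folklore] -/
theorem pinnedContourBound_of_readingsM {L : ℕ} {β' β₀ : ℝ}
    (h : LineageReadingsM M G C K Kc R g A Bad jlo nup Δ Δ₁ Nanc cA cB dC c₃) (hC : C.Valid) (hA0 : 0 ≤ C.A₀)
    (hx0 : ∀ s, s ≤ Kc → 0 ≤ Real.log ((g s) ^ 2)⁻¹) (h29 : B14FlowStep.FlowIneq29 R g L β' β₀ Kc) (hL : 1 ≤ L)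
    (hR1 : ∀ s, s ≤ Kc → 1 ≤ R s) (hpay : PayIneqs C L Kc R g) (hcA : 0 < cA) (hcB : 0 < cB) (hdC : 0 ≤ dC) :
    M.PinnedContourBound A (Real.exp (-(rateB C.κ₁ C.Eb C.μ (2 * cA) (cB + 2 * cA * dC) - c₃))) nup := by
  classical
  obtain ⟨mem, vol, rest, tcut, hlin, hrest, hrem⟩ := h.lineage
  have hC₁ : 0 < 2 * cA := by positivity
  have hC₂ : 0 < cB + 2 * cA * dC := by positivity
  have hrate0 : 0 ≤ rateB C.κ₁ C.Eb C.μ (2 * cA) (cB + 2 * cA * dC) :=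
    rateB_nonneg hC.κ₁_nonneg hC.Eb_nonneg hC.μ_nonneg hC₁.le hC₂.le
  have hfac := factor_of_surplusK (M := M) (A := A) (rest := rest)
    (S := fun 𝒦 τ => ∑ lam ∈ mem τ 𝒦, (credits (credit C g ∘ Prod.snd) (G lam) -
      lifeCost (dictWT Prod.snd R C.n₁) (costT Prod.snd C Kc R) (G lam)))
    (s := rateB C.κ₁ C.Eb C.μ (2 * cA) (cB + 2 * cA * dC)) hrest
    (fun 𝒦 τ hτ hc => (hlin 𝒦 τ hτ hc).2.2)
    (fun 𝒦 τ hτ hc => by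
      obtain ⟨hmem, hcover, -⟩ := hlin 𝒦 τ hτ hc
      -- each member pays `rateB` per cell of its share
      have hper : ∀ lam ∈ mem τ 𝒦, rateB C.κ₁ C.Eb C.μ (2 * cA) (cB + 2 * cA * dC) * (vol τ 𝒦 lam : ℝ) ≤
          credits (credit C g ∘ Prod.snd) (G lam) -
            lifeCost (dictWT Prod.snd R C.n₁) (costT Prod.snd C Kc R) (G lam) := by
        intro lam hlam
        obtain ⟨hcons, hwf, hcut, hcells⟩ := hmem lam hlam
        exact surplus_ge_rateB_T hC h29 hL hR1 hpay hA0 hx0 hC₁ hC₂ hcons hwf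
          (volumeAccounting_of_consistentTLE_T (cost := costT Prod.snd C Kc R) (credit := credit C g ∘ Prod.snd)
            hcA.le hcB.le hdC hcons hwf hcut hcells)
      calc rateB C.κ₁ C.Eb C.μ (2 * cA) (cB + 2 * cA * dC) * (𝒦.card : ℝ)
          ≤ rateB C.κ₁ C.Eb C.μ (2 * cA) (cB + 2 * cA * dC) * ∑ lam ∈ mem τ 𝒦, (vol τ 𝒦 lam : ℝ) :=
            mul_le_mul_of_nonneg_left hcover hrate0
        _ = ∑ lam ∈ mem τ 𝒦, rateB C.κ₁ C.Eb C.μ (2 * cA) (cB + 2 * cA * dC) * (vol τ 𝒦 lam : ℝ) := by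
            rw [mul_sum]
        _ ≤ ∑ lam ∈ mem τ 𝒦, (credits (credit C g ∘ Prod.snd) (G lam) -
              lifeCost (dictWT Prod.snd R C.n₁) (costT Prod.snd C Kc R) (G lam)) := sum_le_sum hper)
  have hsplit : M.PinnedSplitK A rest (Real.exp (-rateB C.κ₁ C.Eb C.μ (2 * cA) (cB + 2 * cA * dC)))
      (Real.exp c₃) nup :=
    ⟨hrest, hfac, hrem⟩
  have key := OccModel.pinnedContourBound_of_splitK hsplit (Real.exp_nonneg _)
  have hq : Real.exp (-rateB C.κ₁ C.Eb C.μ (2 * cA) (cB + 2 * cA * dC)) * Real.exp c₃ =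
      Real.exp (-(rateB C.κ₁ C.Eb C.μ (2 * cA) (cB + 2 * cA * dC) - c₃)) := by
    rw [← Real.exp_add]
    congr 1
    ring
  rw [hq] at key
  exact key

end OneRun

/-! ## §2 The flow END without separation -/

section Flow

variable {ι : Type*} [DecidableEq ι]

/-- NAMED SHAPE `RunReadingsFlowM …` (ONE run, ONE `(K, t)`): as `RunReadingsFlowT`, with member-family readings over
SOME lineage type `Λ` with tagged genealogies `G`.  A hypothesis shape; nothing asserted. [folklore] -/
def RunReadingsFlowM (C : T4PrintedShapeBanking.Consts) (L r : ℕ) (β₀ x₀ : ℝ) (T : ℕ → Finset ι)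
    (X : ℕ → ℝ → ι → ℝ) (Bad : ℕ → ℝ → Finset ι) (xup : ℕ → ℝ → ℝ) (jstar : ℕ → ℕ) (Δ₁ Nanc cA cB dC c₃ : ℝ)
    (K : ℕ) (t : ℝ) : Prop :=
  ∃ (Cell : Type) (_ : Fintype Cell) (_ : DecidableEq Cell) (M : OccModel ι Cell) (_ : DecidableRel M.Adj.Adj)
    (Λ : Type) (G : Λ → Gen (ℕ × PEv)) (Δ Kc : ℕ) (R : ℕ → ℕ) (g : ℕ → ℝ) (β' : ℝ),
    M.T = T K ∧ B14.FlowIneq27 g β' β₀ C.p₀ Kc ∧ B14FlowStep.FlowIneq29 R g L β' β₀ Kc ∧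
    (∀ s, s ≤ Kc → B14.IsRj L r (g s) (R s)) ∧ (∀ s, s ≤ Kc → 1 ≤ Real.log ((g s) ^ 2)⁻¹) ∧
    x₀ ≤ Real.log ((g Kc) ^ 2)⁻¹ ∧
    LineageReadingsM M G C K Kc R g (X K t) (Bad K t) (jstar K) (xup K t) Δ Δ₁ Nanc cA cB dC c₃

omit [DecidableEq ι] in
/-- the member-family readings of a run with its pay inequalities give its `OccLeaves`. [folklore] -/
theorem occLeaves_of_readingsM {C : T4PrintedShapeBanking.Consts} (hC : C.Valid) (hA0 : 0 ≤ C.A₀) {L : ℕ}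
    (hL : 1 ≤ L) {Δ₁ Nanc cA cB dC c₃ : ℝ} (hcA : 0 < cA) (hcB : 0 < cB) (hdC : 0 ≤ dC) {T : ℕ → Finset ι}
    {X : ℕ → ℝ → ι → ℝ} {Bad : ℕ → ℝ → Finset ι} {xup : ℕ → ℝ → ℝ} {jstar : ℕ → ℕ} {K : ℕ} {t : ℝ}
    {Cell : Type} [Fintype Cell] [DecidableEq Cell] {M : OccModel ι Cell} [DecidableRel M.Adj.Adj]
    {Λ : Type} {G : Λ → Gen (ℕ × PEv)} {Δ Kc : ℕ} {R : ℕ → ℕ} {g : ℕ → ℝ} {β' β₀ : ℝ} {r : ℕ}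
    (hT : M.T = T K) (h29 : B14FlowStep.FlowIneq29 R g L β' β₀ Kc) (hRj : ∀ s, s ≤ Kc → B14.IsRj L r (g s) (R s))
    (hx1 : ∀ s, s ≤ Kc → 1 ≤ Real.log ((g s) ^ 2)⁻¹) (hpay : PayIneqs C L Kc R g)
    (hLM : LineageReadingsM M G C K Kc R g (X K t) (Bad K t) (jstar K) (xup K t) Δ Δ₁ Nanc cA cB dC c₃) :
    OccLeaves T X Bad xup jstar Nanc Δ₁ (rateB C.κ₁ C.Eb C.μ (2 * cA) (cB + 2 * cA * dC) - c₃) K t := by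
  refine ⟨Cell, inferInstance, inferInstance, M, inferInstance, Δ, hT, hLM.deg, hLM.animal, hLM.anchors, hLM.cover,
    ?_, ?_⟩
  · exact pinnedContourBound_of_readingsM hLM hC hA0 (fun s hs => by linarith [hx1 s hs]) h29 hL
      (one_le_R hRj hL) hpay hcA hcB hdC
  · intro τ hτ
    exact hLM.nonneg τ (hT ▸ hτ)

/-- **THE END OF THE CONTOUR ROUTE WITHOUT SEPARATION — ONE INFRARED THRESHOLD, SURVIVAL AUTOMATIC, EVERY HISTORY
ADMITTED, CONTOURS MAY MEET SEVERAL LIVE COMPONENTS.**  Statement shape = `exists_irThresholdT_relWeightBound` with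
`RunReadingsFlowM` for `RunReadingsFlowT`. [folklore] -/
theorem exists_irThresholdM_relWeightBound (C₀ : T4PrintedShapeBanking.Consts) (hC₀ : C₀.Valid) (ha : 0 < C₀.a)
    (hA : 0 < C₀.A₀) {L r : ℕ} (hL : 1 ≤ L) {β₀ : ℝ} (hβ : 0 ≤ β₀) (hrq : r * (C₀.q' + 1) < C₀.p₀)
    {Δ₁ cA cB dC : ℝ} (hΔ₁ : 0 < Δ₁) (hcA : 0 < cA) (hcB : 0 < cB) (hdC : 0 ≤ dC) (c₃ : ℝ) :
    ∃ x₀ : ℝ, ∀ (l₀ : ℝ) (T : ℕ → Finset ι) (A B : ℕ → ℝ → ι → ℝ) (Bad : ℕ → ℝ → Finset ι)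
      (nup mup nlow mlow : ℕ → ℝ → ℝ) (Cst : ℝ) (K₀ : ℕ) (jstar : ℕ → ℕ) (Nanc c : ℝ),
      (∀ K t, |t| ≤ l₀ → K₀ ≤ K → RunReadingsFlowM (withBanks C₀ (survivalRate Δ₁ c₃) (2 * cA) (cB + 2 * cA * dC))
        L r β₀ x₀ T A Bad nup jstar Δ₁ Nanc cA cB dC c₃ K t) →
      (∀ K t, |t| ≤ l₀ → K₀ ≤ K → RunReadingsFlowM (withBanks C₀ (survivalRate Δ₁ c₃) (2 * cA) (cB + 2 * cA * dC))
        L r β₀ x₀ T B Bad mup jstar Δ₁ Nanc cA cB dC c₃ K t) →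
      LowEnvelope l₀ T A nlow nup Cst K₀ → LowEnvelope l₀ T B mlow mup Cst K₀ → 0 ≤ Cst →
      (∀ K, jstar K ≤ K) → 0 ≤ Nanc → 0 < c → (∀ K : ℕ, c * K ≤ ((K - jstar K : ℕ) : ℝ)) →
      ∃ K₁, K₀ ≤ K₁ ∧ RelWeightBound l₀ T A B (fun K t => if K₁ ≤ K then Bad K t else ∅)
        (Set.indicator {K | K₁ ≤ K} (fun K => Cst *
          contourBudget Nanc (Δ₁ * Real.exp (-(survivalRate Δ₁ c₃ - c₃))) jstar K)) := by
  have hC₁ : 0 < 2 * cA := by positivity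
  have hC₂ : 0 < cB + 2 * cA * dC := by positivity
  set C := withBanks C₀ (survivalRate Δ₁ c₃) (2 * cA) (cB + 2 * cA * dC) with hC
  have hV : C.Valid := withBanks_valid hC₀ (survivalRate_nonneg Δ₁ c₃) hC₁.le hC₂.le
  have hrate : rateB C.κ₁ C.Eb C.μ (2 * cA) (cB + 2 * cA * dC) = survivalRate Δ₁ c₃ := rateB_withBanks hC₁ hC₂
  have hA0 : 0 ≤ C.A₀ := hA.le
  obtain ⟨x₀, hx₀⟩ := exists_payThreshold C hV ha hA hL hβ hrq
  refine ⟨x₀, ?_⟩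
  intro l₀ T A B Bad nup mup nlow mlow Cst K₀ jstar Nanc c hRA hRB hEA hEB hCst hj hNanc hc hfrac
  have toLeaves : ∀ {X : ℕ → ℝ → ι → ℝ} {xup : ℕ → ℝ → ℝ} {K : ℕ} {t : ℝ},
      RunReadingsFlowM C L r β₀ x₀ T X Bad xup jstar Δ₁ Nanc cA cB dC c₃ K t →
        OccLeaves T X Bad xup jstar Nanc Δ₁ (rateB C.κ₁ C.Eb C.μ (2 * cA) (cB + 2 * cA * dC) - c₃) K t := by
    intro X xup K t h
    obtain ⟨Cell, hF, hD, M, hR, Λ, G, Δ, Kc, R, g, β', hT, h27, h29, hRj, hx1, hxK, hL'⟩ := h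
    exact occLeaves_of_readingsM hV hA0 hL hcA hcB hdC hT h29 hRj hx1 (hx₀ Kc R g β' h27 hRj hx1 hxK) hL'
  have key := exists_relWeightBound_of_occLeaves
    (fun K t ht hK => toLeaves (hRA K t ht hK)) (fun K t ht hK => toLeaves (hRB K t ht hK))
    hEA hEB hCst hj hNanc hΔ₁ (by rw [hrate]; exact survives_of_lt hΔ₁ (lt_survivalRate Δ₁ c₃)) hc hfrac
  rw [hrate] at key
  exact key

end Flow

end

end Summit.QuantumFields.BalabanUV.T4Continuum.SpaceTimePeierls
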